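import Literature.Analysis.FluidPDE.DeRosaGluingPotential
import Literature.Analysis.FluidPDE.FractionalNSReynoldsLimit
import HarnessLib

/-!
# Discharge of `BDSV.gluingStability` (BDSV §3: Cor. 3.2, Prop. 3.3, Prop. 3.4)

Buckmaster–De Lellis–Székelyhidi–Vicol (BDSV), *Onsager's conjecture for admissible weak
solutions*, Comm. Pure Appl. Math. 72 (2019) 229–274 = arXiv:1701.08678, §3 "Stability
estimates for classical exact solutions": for the exact solutions `vᵢ` of (3.1)
(`vᵢ(·, tᵢ) = v_ℓ(·, tᵢ)`, `tᵢ = iτ_q`) one has, for `|t - tᵢ| ≤ τ_q`, Cor. 3.2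
`‖vᵢ‖_{N+α} ≲ τ_q⁻¹ ℓ^{1-N+α}` (`N ≥ 1`), Prop. 3.3 `‖vᵢ - v_ℓ‖_{N+α} ≲ τ_q δ_{q+1} ℓ^{-N-1+α}`,
`‖∇(p_ℓ - pᵢ)‖_{N+α} ≲ δ_{q+1} ℓ^{-N-1+α}`, `‖D_{t,ℓ}(vᵢ - v_ℓ)‖_{N+α} ≲ δ_{q+1} ℓ^{-N-1+α}`, and
Prop. 3.4 `‖zᵢ - zᵢ₊₁‖_{N+α} ≲ τ_q δ_{q+1} ℓ^{-N+α}`, `‖D_{t,ℓ}(zᵢ - zᵢ₊₁)‖_{N+α} ≲ δ_{q+1} ℓ^{-N+α}`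
for the vector potentials `zᵢ = ℬvᵢ` ("Set `z̃ᵢ := ℬ(vᵢ - v_ℓ)` and observe that
`zᵢ - zᵢ₊₁ = z̃ᵢ - z̃ᵢ₊₁`"). The named fact `BDSV.gluingStability` (`OnsagerBDSVGluing.lean`)
transcribes §3 in the currency of the scheme (`BDSV.StabilityBounds`, `BDSV.PotentialBounds`).

This file PROVES it (`BDSV.gluingStability_holds`). Every analytic step of the printed proofs is
already in the tree in dimensionless form, with the Calderón–Zygmund input Prop. C.1 discharged
(`BDSV.holderCZBound_holds`, `OnsagerBDSVPotentialTheoryProofs.lean`):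

* Prop. 3.1 (3.2) / Cor. 3.2 for every smooth exact solution: `BDSV.holderCZBound.eulerApriori`
  (`OnsagerBDSVEulerApriori.lean`);
* Prop. 3.3: `BDSV.holderCZBound.stability33` (`OnsagerBDSVStability33.lean`);
* Prop. 3.4 for one exact solution anchored to `v_ℓ` at the LEFT endpoint of the time interval:
  `DeRosa.fracPotentialStability` (`FracNSPotentialStability.lean`; De Rosa 2019, Prop. 5.4 is
  BDSV Prop. 3.4 for the fractional Navier–Stokes equations with viscosity `ν ≥ 0`, and with
  `ν = 0` the system is Euler–Reynolds, `Torus.IsEulerReynoldsOn.isFracNSReynoldsOn_zero_visc`).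

What is added here:

* `Torus.IsEulerReynoldsOn.timeReflect` — the time-reversal symmetry of the Euler–Reynolds
  system, `(v, p, R̊)(t) ↦ (-v, p, R̊)(-t)`, mapping triples on `[a,b]` to triples on `[-b,-a]`
  (the exact solutions of §3 live on both sides of their anchors `tᵢ`, `|t - tᵢ| ≤ τ_q`, whereas
  De Rosa's forward-parabolic twin is anchored at left endpoints);
* `BDSV.potentialStability_left` / `BDSV.potentialStability_right` — Prop. 3.4 for one exact
  solution, dimensionless, anchored at either endpoint (the right-anchored case from the
  left-anchored one by time reversal: `ℬ` is linear and `D_{t,ℓ}` is even under the reflection);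
* `BDSV.stabilityBounds_of_exactEuler` — Cor. 3.2 and Prop. 3.3 in the currency of the scheme
  (the interpolation of (2.13), `‖v_ℓ(t)‖_{N+1+α} ≲ δ_q^{1/2}λ_qℓ^{-N-α}`, the CFL condition
  `τ_q‖v_ℓ‖_{1+α} ≲ ℓ^α ≪ 1` of §2.5, and `τ_q δ_q^{1/2} λ_q = ℓ^{2α}`), for every smooth exact
  solution on `Sᵢ = [tᵢ - τ_q, tᵢ + τ_q] ∩ [0,T]` with `v(tᵢ) = v_ℓ(tᵢ)`;
* `BDSV.potentialBounds_of_exactEuler` — Prop. 3.4 in the currency of the scheme on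
  `Sᵢ ∩ Sᵢ₊₁ = [tᵢ, tᵢ₊₁]` (`vᵢ` is anchored at the left endpoint `tᵢ`, `vᵢ₊₁` at the right
  endpoint `tᵢ₊₁`);
* `BDSV.gluingStability_holds`.

No definitions and no named facts are introduced.

## References

* T. Buckmaster, C. De Lellis, L. Székelyhidi Jr., V. Vicol, *Onsager's conjecture for admissible
  weak solutions*, Comm. Pure Appl. Math. 72 (2019) 229–274 = arXiv:1701.08678: §3.1 Cor. 3.2,
  §3.2 Prop. 3.3 (3.6)–(3.9), §3.3 Prop. 3.4 and its proof (arXiv pp. 9–10), §2.5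
  (CFL condition, (2.16)). [`BuckmasterEtAl2018`]
* L. De Rosa, *Infinitely many Leray–Hopf solutions for the fractional Navier–Stokes equations*,
  Comm. PDE 44 (2019) 335–365 = arXiv:1801.10235, §5.2 Prop. 5.4. [`Derosa2018`]
-/

noncomputable section

open MeasureTheory Set Filter Function
open scoped NNReal ENNReal ContDiff

namespace Literature.Analysis.FluidPDE

open FunctionSpaces FunctionSpaces.Torus

/-! ## Time reversal of Euler–Reynolds triples -/

section Reflect

variable {F : Type*} [NormedAddCommGroup F] [NormedSpace ℝ F]

/-- Joint smoothness is preserved by the time reflection `(t, x) ↦ w (-t) x` from `[a, b]` to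
`[-b, -a]`. [folklore] -/
theorem isSmoothSpaceTimeOn_comp_neg {a b : ℝ} {w : ℝ → UnitAddTorus (Fin 3) → F}
    (hw : FunctionSpaces.Torus.IsSmoothSpaceTimeOn (Icc a b) w) :
    FunctionSpaces.Torus.IsSmoothSpaceTimeOn (Icc (-b) (-a)) (fun t x => w (-t) x) := by
  have hφ : ContDiff ℝ ∞ (fun z : ℝ × EuclideanSpace ℝ (Fin 3) => ((-z.1, z.2) : ℝ × EuclideanSpace ℝ (Fin 3))) :=
    contDiff_fst.neg.prodMk contDiff_snd
  have hmaps : MapsTo (fun z : ℝ × EuclideanSpace ℝ (Fin 3) => ((-z.1, z.2) : ℝ × EuclideanSpace ℝ (Fin 3))) (Icc (-b) (-a) ×ˢ univ) (Icc a b ×ˢ univ) := by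
    rintro ⟨t, y⟩ hz
    obtain ⟨⟨h1, h2⟩, -⟩ := mem_prod.1 hz
    exact mk_mem_prod ⟨by linarith, by linarith⟩ (mem_univ _)
  exact hw.comp hφ.contDiffOn hmaps

/-- The one-sided time derivative of the reflected and negated field `(t, x) ↦ -w(-t, x)` within
`[-b, -a]` is the time derivative of `w` within `[a, b]` at the reflected time. [folklore] -/
theorem timeDerivWithin_neg_comp_neg {a b : ℝ} (hab : a < b) {w : ℝ → UnitAddTorus (Fin 3) → F}
    (hw : FunctionSpaces.Torus.IsSmoothSpaceTimeOn (Icc a b) w) {t : ℝ} (ht : t ∈ Icc (-b) (-a)) (x : UnitAddTorus (Fin 3)) :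
    FunctionSpaces.Torus.timeDerivWithin (Icc (-b) (-a)) (fun s y => -w (-s) y) t x = FunctionSpaces.Torus.timeDerivWithin (Icc a b) w (-t) x := by
  have hnt : -t ∈ Icc a b := ⟨by linarith [ht.2], by linarith [ht.1]⟩
  have hg : HasDerivWithinAt (fun τ => w τ x) (FunctionSpaces.Torus.timeDerivWithin (Icc a b) w (-t) x) (Icc a b) (-t) :=
    hw.hasDerivWithinAt_slice hnt x
  have hh : HasDerivWithinAt (fun τ : ℝ => -τ) (-1) (Icc (-b) (-a)) t := hasDerivWithinAt_neg t _
  have hmaps : MapsTo (fun τ : ℝ => -τ) (Icc (-b) (-a)) (Icc a b) := fun τ hτ =>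
    ⟨by linarith [hτ.2], by linarith [hτ.1]⟩
  have hcomp := (hg.scomp t hh hmaps).neg
  rw [neg_one_smul, neg_neg] at hcomp
  exact hcomp.derivWithin (uniqueDiffOn_Icc (by linarith) t ht)

/-- `D(-f) = -Df` on the torus (no differentiability needed, as for Mathlib's `fderiv_neg`). [folklore] -/
theorem fderiv_fun_neg' (f : UnitAddTorus (Fin 3) → F) (x : UnitAddTorus (Fin 3)) :
    Torus.fderiv (fun y => -f y) x = -Torus.fderiv f x := by
  unfold Torus.fderiv
  rw [show liftAt (fun y => -f y) x = fun v => -(liftAt f x v) from rfl]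
  exact _root_.fderiv_fun_neg

/-- `((-u)·∇)(-w) = (u·∇)w`. [folklore] -/
theorem convect_neg_neg (u : UnitAddTorus (Fin 3) → EuclideanSpace ℝ (Fin 3)) (w : UnitAddTorus (Fin 3) → F) (x : UnitAddTorus (Fin 3)) :
    FunctionSpaces.Torus.convect (fun y => -u y) (fun y => -w y) x = FunctionSpaces.Torus.convect u w x := by
  simp only [FunctionSpaces.Torus.convect]
  rw [fderiv_fun_neg']
  simp

/-- **Time-reversal symmetry of the Euler–Reynolds system.** If `(v, p, R̊)` is an
Euler–Reynolds triple on `[a, b] × T³`, then `(t, x) ↦ (-v(-t, x), p(-t, x), R̊(-t, x))` is an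
Euler–Reynolds triple on `[-b, -a] × T³`: `∂ₜ(-v(-t)) = (∂ₜv)(-t)`, `((-v)·∇)(-v) = (v·∇)v`.
[folklore] -/
theorem Torus.IsEulerReynoldsOn.timeReflect {a b : ℝ} (hab : a < b) {v : ℝ → UnitAddTorus (Fin 3) → EuclideanSpace ℝ (Fin 3)}
    {p : ℝ → UnitAddTorus (Fin 3) → ℝ} {R : ℝ → UnitAddTorus (Fin 3) → Fin 3 → EuclideanSpace ℝ (Fin 3)} (h : Torus.IsEulerReynoldsOn (Icc a b) v p R) :
    Torus.IsEulerReynoldsOn (Icc (-b) (-a)) (fun t x => -v (-t) x) (fun t x => p (-t) x)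
      (fun t x => R (-t) x) where
  smooth_velocity := (isSmoothSpaceTimeOn_comp_neg h.smooth_velocity).neg
  smooth_pressure := isSmoothSpaceTimeOn_comp_neg h.smooth_pressure
  smooth_stress := isSmoothSpaceTimeOn_comp_neg h.smooth_stress
  momentum t ht x := by
    have hnt : -t ∈ Icc a b := ⟨by linarith [ht.2], by linarith [ht.1]⟩
    have h1 : FunctionSpaces.Torus.timeDerivWithin (Icc (-b) (-a)) (fun s y => -v (-s) y) t x = FunctionSpaces.Torus.timeDerivWithin (Icc a b) v (-t) x :=
      timeDerivWithin_neg_comp_neg hab h.smooth_velocity ht x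
    have h2 : FunctionSpaces.Torus.convect (fun y => -v (-t) y) (fun y => -v (-t) y) x = FunctionSpaces.Torus.convect (v (-t)) (v (-t)) x :=
      convect_neg_neg (v (-t)) (v (-t)) x
    rw [h1, h2]
    exact h.momentum (-t) hnt x
  divFree t ht x := by
    have hnt : -t ∈ Icc a b := ⟨by linarith [ht.2], by linarith [ht.1]⟩
    have hvs : IsSmooth (v (-t)) := h.smooth_velocity.isSmooth_slice hnt
    have e : (fun y => -v (-t) y) = (-1 : ℝ) • v (-t) := by
      funext y; simp
    rw [e, Torus.divergence_const_smul (hvs.isContDiff (by simp)), h.divFree (-t) hnt x, mul_zero]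
  symm t ht x i j := h.symm (-t) ⟨by linarith [ht.2], by linarith [ht.1]⟩ x i j
  traceFree t ht x := h.traceFree (-t) ⟨by linarith [ht.2], by linarith [ht.1]⟩ x
  hasZeroMean_pressure t ht := h.hasZeroMean_pressure (-t) ⟨by linarith [ht.2], by linarith [ht.1]⟩

end Reflect

namespace BDSV

/-! ## Prop. 3.4 for one exact solution, dimensionless, anchored at either endpoint -/

section PotentialDimensionless

/-- **BDSV Prop. 3.4 for one exact solution, dimensionless form, anchored at the left endpoint**
(proof of Prop. 3.4: the transport equation of `z̃ᵢ = ℬ(vᵢ - v_ℓ)`, the Hölder bounds of the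
zero-order operators, (B.2) and Grönwall; here the case `ν = 0` of De Rosa's Prop. 5.4 in the
tree, `DeRosa.fracPotentialStability`): for `0 < α < 1` and `N̄` there are `c > 0`, `C ≥ 0` such
that for an Euler–Reynolds triple `(v_ℓ, p_ℓ, R̊_ℓ)` and an exact Euler solution `(v, p)` on
`[a,b] × T³` with `v(a) = v_ℓ(a)`, `‖v_ℓ(s)‖_{m,α}, ‖v(s)‖_{m,α} ≤ UΛ^{m-1}` (`1 ≤ m ≤ N̄+1`),
`‖R̊_ℓ(s)‖_{m,α} ≤ EΛ^m` (`m ≤ N̄`) and `(b-a)U ≤ c`, the potential `z̃ = ℬ(v - v_ℓ)` satisfies for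
`s ∈ [a,b]`, `N ≤ N̄`: `‖z̃(s)‖_{N,α} ≤ C(b-a)EΛ^N` and `‖(∂ₜ + v_ℓ·∇)z̃(s)‖_{N,α} ≤ CEΛ^N`.
[cite: BuckmasterEtAl2018, §3.3, Prop. 3.4] -/
theorem potentialStability_left {α : ℝ≥0} (hα : 0 < α) (hα1 : α < 1) (Nbar : ℕ) :
    ∃ c : ℝ, 0 < c ∧ ∃ C : ℝ, 0 ≤ C ∧ ∀ {a b : ℝ} (_ : a < b)
      {vℓ v : ℝ → UnitAddTorus (Fin 3) → EuclideanSpace ℝ (Fin 3)} {pℓ p : ℝ → UnitAddTorus (Fin 3) → ℝ} {Rℓ : ℝ → UnitAddTorus (Fin 3) → Fin 3 → EuclideanSpace ℝ (Fin 3)}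
      (_ : Torus.IsEulerReynoldsOn (Icc a b) vℓ pℓ Rℓ) (_ : IsExactEulerOn (Icc a b) v p)
      (_ : v a = vℓ a) {U Λ E : ℝ} (_ : 0 < U) (_ : 1 ≤ Λ) (_ : 0 ≤ E)
      (_ : ∀ s ∈ Icc a b, ∀ m, 1 ≤ m → m ≤ Nbar + 1 →
        Torus.eContDiffHolderNorm m α (vℓ s) ≤ ENNReal.ofReal (U * Λ ^ (m - 1)))
      (_ : ∀ s ∈ Icc a b, ∀ m, 1 ≤ m → m ≤ Nbar + 1 →
        Torus.eContDiffHolderNorm m α (v s) ≤ ENNReal.ofReal (U * Λ ^ (m - 1)))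
      (_ : ∀ s ∈ Icc a b, ∀ m, m ≤ Nbar →
        Torus.eContDiffHolderNorm m α (Rℓ s) ≤ ENNReal.ofReal (E * Λ ^ m))
      (_ : (b - a) * U ≤ c),
      ∀ s ∈ Icc a b, ∀ N, N ≤ Nbar →
        Torus.eContDiffHolderNorm N α (biotSavart (fun y => v s y - vℓ s y)) ≤ ENNReal.ofReal (C * (b - a) * E * Λ ^ N) ∧
        Torus.eContDiffHolderNorm N α (fun x =>
          FunctionSpaces.Torus.timeDerivWithin (Icc a b) (fun t y => biotSavart (fun z => v t z - vℓ t z) y) s x +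
            FunctionSpaces.Torus.convect (vℓ s) (biotSavart (fun y => v s y - vℓ s y)) x) ≤ ENNReal.ofReal (C * E * Λ ^ N) := by
  obtain ⟨c, hc, C, hC, h⟩ := DeRosa.fracPotentialStability hα hα1 Nbar
  refine ⟨c, hc, C, hC, fun hab vℓ v pℓ p Rℓ hℓ hv hanch U Λ E hU hΛ hE hvℓ hvv hR hcfl s hs N hN => ?_⟩
  have key := h hab (γ := 1 / 2) (ν := 0) le_rfl (by norm_num) (by norm_num)
    (hℓ.isFracNSReynoldsOn_zero_visc (1 / 2)) (hv.isFracNSReynoldsOn_zero_visc (1 / 2)) hanch hU hΛ hE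
    hvℓ hvv hR hcfl s hs N hN
  simp only [zero_smul, add_zero] at key
  exact key

/-- **BDSV Prop. 3.4 for one exact solution, dimensionless form, anchored at the right endpoint**
(`v(b) = v_ℓ(b)`; from `BDSV.potentialStability_left` by the time-reversal symmetry
`Torus.IsEulerReynoldsOn.timeReflect`: the potential of the reflected pair at time `-s` is
`-z̃(s)` and its transport derivative along the reflected `v_ℓ` is `(D_{t,ℓ} z̃)(s)`).
[cite: BuckmasterEtAl2018, §3.3, Prop. 3.4] -/
theorem potentialStability_right {α : ℝ≥0} (hα : 0 < α) (hα1 : α < 1) (Nbar : ℕ) :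
    ∃ c : ℝ, 0 < c ∧ ∃ C : ℝ, 0 ≤ C ∧ ∀ {a b : ℝ} (_ : a < b)
      {vℓ v : ℝ → UnitAddTorus (Fin 3) → EuclideanSpace ℝ (Fin 3)} {pℓ p : ℝ → UnitAddTorus (Fin 3) → ℝ} {Rℓ : ℝ → UnitAddTorus (Fin 3) → Fin 3 → EuclideanSpace ℝ (Fin 3)}
      (_ : Torus.IsEulerReynoldsOn (Icc a b) vℓ pℓ Rℓ) (_ : IsExactEulerOn (Icc a b) v p)
      (_ : v b = vℓ b) {U Λ E : ℝ} (_ : 0 < U) (_ : 1 ≤ Λ) (_ : 0 ≤ E)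
      (_ : ∀ s ∈ Icc a b, ∀ m, 1 ≤ m → m ≤ Nbar + 1 →
        Torus.eContDiffHolderNorm m α (vℓ s) ≤ ENNReal.ofReal (U * Λ ^ (m - 1)))
      (_ : ∀ s ∈ Icc a b, ∀ m, 1 ≤ m → m ≤ Nbar + 1 →
        Torus.eContDiffHolderNorm m α (v s) ≤ ENNReal.ofReal (U * Λ ^ (m - 1)))
      (_ : ∀ s ∈ Icc a b, ∀ m, m ≤ Nbar →
        Torus.eContDiffHolderNorm m α (Rℓ s) ≤ ENNReal.ofReal (E * Λ ^ m))
      (_ : (b - a) * U ≤ c),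
      ∀ s ∈ Icc a b, ∀ N, N ≤ Nbar →
        Torus.eContDiffHolderNorm N α (biotSavart (fun y => v s y - vℓ s y)) ≤ ENNReal.ofReal (C * (b - a) * E * Λ ^ N) ∧
        Torus.eContDiffHolderNorm N α (fun x =>
          FunctionSpaces.Torus.timeDerivWithin (Icc a b) (fun t y => biotSavart (fun z => v t z - vℓ t z) y) s x +
            FunctionSpaces.Torus.convect (vℓ s) (biotSavart (fun y => v s y - vℓ s y)) x) ≤ ENNReal.ofReal (C * E * Λ ^ N) := by
  obtain ⟨c, hc, C, hC, h⟩ := potentialStability_left hα hα1 Nbar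
  refine ⟨c, hc, C, hC, fun {a b} hab {vℓ v pℓ p Rℓ} hℓ hv hanch {U Λ E} hU hΛ hE hvℓ hvv hR hcfl s hs N hN => ?_⟩
  have hab' : -b < -a := by linarith
  -- the reflected data
  have hℓ' := hℓ.timeReflect hab
  have hv' : IsExactEulerOn (Icc (-b) (-a)) (fun t x => -v (-t) x) (fun t x => p (-t) x) := hv.timeReflect hab
  have hanch' : (fun x => -v (-(-b)) x) = fun x => -vℓ (-(-b)) x := by
    rw [neg_neg, hanch]
  have mem_of : ∀ {r : ℝ}, r ∈ Icc (-b) (-a) → -r ∈ Icc a b := fun hr => ⟨by linarith [hr.2], by linarith [hr.1]⟩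
  have hvℓ' : ∀ r ∈ Icc (-b) (-a), ∀ m, 1 ≤ m → m ≤ Nbar + 1 →
      Torus.eContDiffHolderNorm m α (fun x => -vℓ (-r) x) ≤ ENNReal.ofReal (U * Λ ^ (m - 1)) := by
    intro r hr m hm1 hm2
    rw [show (fun x => -vℓ (-r) x) = -vℓ (-r) from rfl, Torus.eContDiffHolderNorm_neg]
    exact hvℓ (-r) (mem_of hr) m hm1 hm2
  have hvv' : ∀ r ∈ Icc (-b) (-a), ∀ m, 1 ≤ m → m ≤ Nbar + 1 →
      Torus.eContDiffHolderNorm m α (fun x => -v (-r) x) ≤ ENNReal.ofReal (U * Λ ^ (m - 1)) := by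
    intro r hr m hm1 hm2
    rw [show (fun x => -v (-r) x) = -v (-r) from rfl, Torus.eContDiffHolderNorm_neg]
    exact hvv (-r) (mem_of hr) m hm1 hm2
  have hR' : ∀ r ∈ Icc (-b) (-a), ∀ m, m ≤ Nbar →
      Torus.eContDiffHolderNorm m α (Rℓ (-r)) ≤ ENNReal.ofReal (E * Λ ^ m) :=
    fun r hr m hm => hR (-r) (mem_of hr) m hm
  have hcfl' : (-a - -b) * U ≤ c := by rw [show -a - -b = b - a by ring]; exact hcfl
  have hns : -s ∈ Icc (-b) (-a) := ⟨by linarith [hs.2], by linarith [hs.1]⟩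
  obtain ⟨k1, k2⟩ := h hab' hℓ' hv' hanch' hU hΛ hE hvℓ' hvv' hR' hcfl' (-s) hns N hN
  simp only [neg_neg] at k1 k2
  rw [show -a - -b = b - a by ring] at k1
  -- smoothness
  have hws : ∀ r ∈ Icc a b, IsSmooth (fun y => v r y - vℓ r y) := fun r hr =>
    (hv.smooth_velocity.isSmooth_slice hr).sub (hℓ.smooth_velocity.isSmooth_slice hr)
  -- the reflected potential is `-z̃` at the reflected time
  have hrefl : ∀ r ∈ Icc a b, (fun y => -v r y - -vℓ r y) = -fun y => v r y - vℓ r y := by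
    intro r _
    funext y
    simp only [Pi.neg_apply]
    abel
  have hZneg : ∀ r ∈ Icc a b, biotSavart (fun y => -v r y - -vℓ r y) = -biotSavart (fun y => v r y - vℓ r y) := by
    intro r hr
    rw [hrefl r hr, biotSavart_neg (hws r hr)]
  refine ⟨?_, ?_⟩
  · rw [hZneg s hs, Torus.eContDiffHolderNorm_neg] at k1
    exact k1
  · -- the transport term of the reflected pair at `-s` is the transport term at `s`
    set Z : ℝ → UnitAddTorus (Fin 3) → EuclideanSpace ℝ (Fin 3) := fun t y => biotSavart (fun z => v t z - vℓ t z) y with hZdef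
    have hZst : FunctionSpaces.Torus.IsSmoothSpaceTimeOn (Icc a b) Z :=
      isSmoothSpaceTimeOn_biotSavart (hv.smooth_velocity.sub hℓ.smooth_velocity) (convex_Icc a b)
        (by rw [interior_Icc]; exact nonempty_Ioo.2 hab)
    have e1 : ∀ x, FunctionSpaces.Torus.timeDerivWithin (Icc (-b) (-a)) (fun t y => biotSavart (fun z => -v (-t) z - -vℓ (-t) z) y) (-s) x =
        FunctionSpaces.Torus.timeDerivWithin (Icc (-b) (-a)) (fun t y => -Z (-t) y) (-s) x := by
      intro x
      unfold FunctionSpaces.Torus.timeDerivWithin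
      refine derivWithin_congr (fun r hr => ?_) ?_
      · show biotSavart (fun z => -v (-r) z - -vℓ (-r) z) x = -Z (-r) x
        rw [hZneg (-r) (mem_of hr)]
        rfl
      · show biotSavart (fun z => -v (-(-s)) z - -vℓ (-(-s)) z) x = -Z (-(-s)) x
        rw [neg_neg, hZneg s hs]
        rfl
    have e2 : ∀ x, FunctionSpaces.Torus.timeDerivWithin (Icc (-b) (-a)) (fun t y => -Z (-t) y) (-s) x = FunctionSpaces.Torus.timeDerivWithin (Icc a b) Z s x := by
      intro x
      rw [timeDerivWithin_neg_comp_neg hab hZst hns x, neg_neg]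
    have e3 : ∀ x, FunctionSpaces.Torus.convect (fun y => -vℓ s y) (biotSavart (fun y => -v s y - -vℓ s y)) x =
        FunctionSpaces.Torus.convect (vℓ s) (biotSavart (fun y => v s y - vℓ s y)) x := by
      intro x
      rw [hZneg s hs]
      exact convect_neg_neg (vℓ s) (biotSavart (fun y => v s y - vℓ s y)) x
    have e : (fun x => FunctionSpaces.Torus.timeDerivWithin (Icc (-b) (-a)) (fun t y => biotSavart (fun z => -v (-t) z - -vℓ (-t) z) y) (-s) x +
        FunctionSpaces.Torus.convect (fun y => -vℓ s y) (biotSavart (fun y => -v s y - -vℓ s y)) x) =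
        fun x => FunctionSpaces.Torus.timeDerivWithin (Icc a b) (fun t y => biotSavart (fun z => v t z - vℓ t z) y) s x +
          FunctionSpaces.Torus.convect (vℓ s) (biotSavart (fun y => v s y - vℓ s y)) x := by
      funext x
      rw [e1 x, e2 x, e3 x]
    rw [e] at k2
    exact k2

end PotentialDimensionless


/-! ## Cor. 3.2 and Prop. 3.3 in the currency of the scheme -/

section Stability

set_option maxHeartbeats 800000 in
/-- **BDSV Cor. 3.2 and Prop. 3.3 for the scheme** (the bounds `BDSV.StabilityBounds` of any
smooth exact Euler solution on `Sᵢ` anchored to `v_ℓ` at `tᵢ = iτ_q`, from the dimensionless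
Cor. 3.2 = `BDSV.holderCZBound.eulerApriori` and Prop. 3.3 = `BDSV.holderCZBound.stability33`
with `BDSV.holderCZBound_holds`, the interpolated form of (2.13)
`‖v_ℓ(t)‖_{N+1+α} ≤ ((N+4)|C_N| + |C_{N+1}|) δ_q^{1/2}λ_qℓ^{-N-α}` and the CFL condition of §2.5,
`2τ_q · U ≲ ℓ^α ≤ c` for `a` large): for `0 < β < 1/3`, `1 < b < (1-β)/(2β)`, `0 < α < 1`, every
`N̄` and every family of input constants `(C_N)` there are `C` and `a₀ > 1` such that for `a ≥ a₀`,
`T > 0`, `q`, every Euler–Reynolds triple `(v_ℓ, p_ℓ, R̊_ℓ)` on `[0,T] × T³` with (2.13)–(2.14),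
every `i` with `iτ_q ≤ T` and every smooth exact Euler solution `(v, p)` on
`Sᵢ = [iτ_q - τ_q, iτ_q + τ_q] ∩ [0,T]` with `v(iτ_q) = v_ℓ(iτ_q)`:
`BDSV.StabilityBounds β α a b T C q N̄ i v_ℓ p_ℓ v p`.
[cite: BuckmasterEtAl2018, Cor. 3.2 and Prop. 3.3 (3.6)–(3.8)] -/
theorem stabilityBounds_of_exactEuler :
    ∀ β : ℝ, 0 < β → β < 1 / 3 → ∀ b : ℝ, 1 < b → b < (1 - β) / (2 * β) →
      ∀ α : ℝ, 0 < α → α < 1 → ∀ (Nbar : ℕ) (Cin : ℕ → ℝ),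
        ∃ (C a₀ : ℝ), 1 < a₀ ∧ ∀ a : ℝ, a₀ ≤ a → ∀ T : ℝ, 0 < T →
          ∀ (q : ℕ) (vℓ : ℝ → UnitAddTorus (Fin 3) → EuclideanSpace ℝ (Fin 3)) (pℓ : ℝ → UnitAddTorus (Fin 3) → ℝ) (Rℓ : ℝ → UnitAddTorus (Fin 3) → Fin 3 → EuclideanSpace ℝ (Fin 3)),
            Torus.IsEulerReynoldsOn (Icc 0 T) vℓ pℓ Rℓ →
            (∀ N : ℕ, HolderSupLE T vℓ (N + 1) 0
              (Cin N * (Real.sqrt (amp β a b q) * freq a b q * mollScale β α a b q ^ (-(N : ℝ))))) →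
            (∀ N : ℕ, HolderSupLE T Rℓ N (Real.toNNReal α)
              (Cin N * (amp β a b (q + 1) * mollScale β α a b q ^ (-(N : ℝ) + α)))) →
            ∀ (i : ℕ) (v : ℝ → UnitAddTorus (Fin 3) → EuclideanSpace ℝ (Fin 3)) (p : ℝ → UnitAddTorus (Fin 3) → ℝ),
              (i : ℝ) * glueScale β α a b q ≤ T →
              IsExactEulerOn (glueInterval T (glueScale β α a b q) i) v p →
              v ((i : ℝ) * glueScale β α a b q) = vℓ ((i : ℝ) * glueScale β α a b q) →
                StabilityBounds β α a b T C q Nbar i vℓ pℓ v p := by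
  intro β hβ _hβ3 b hb _hb' α hα hα1 Nbar Cin
  have hb1 : 1 ≤ b := hb.le
  have hβ0 : 0 ≤ β := hβ.le
  set α' : ℝ≥0 := Real.toNNReal α with hα'def
  have hα' : 0 < α' := Real.toNNReal_pos.2 hα
  have hα1' : α' < 1 := Real.toNNReal_lt_one.2 hα1
  -- the dimensionless constants
  obtain ⟨cA, hcA, CA, hCA1, hAp⟩ := holderCZBound_holds.eulerApriori hα' hα1' (Nbar + 1)
  obtain ⟨cS, hcS, CS, hCS0, hSt⟩ := holderCZBound_holds.stability33 hα' hα1' Nbar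
  -- the input constants, made uniform
  set Kmax : ℝ := ∑ m ∈ Finset.range (Nbar + 1), (((m : ℝ) + 4) * |Cin m| + |Cin (m + 1)|) with hKmax
  have hKmax0 : 0 ≤ Kmax := Finset.sum_nonneg fun _ _ => by positivity
  have hKm : ∀ m : ℕ, m ≤ Nbar → ((m : ℝ) + 4) * |Cin m| + |Cin (m + 1)| ≤ Kmax := fun m hm =>
    Finset.single_le_sum (f := fun m : ℕ => ((m : ℝ) + 4) * |Cin m| + |Cin (m + 1)|) (fun _ _ => by positivity)
      (Finset.mem_range.2 (by omega))
  set Emax : ℝ := ∑ m ∈ Finset.range (Nbar + 2), |Cin m| with hEmax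
  have hEmax0 : 0 ≤ Emax := Finset.sum_nonneg fun _ _ => abs_nonneg _
  have hEm : ∀ m : ℕ, m ≤ Nbar + 1 → |Cin m| ≤ Emax := fun m hm =>
    Finset.single_le_sum (f := fun m : ℕ => |Cin m|) (fun _ _ => abs_nonneg _) (Finset.mem_range.2 (by omega))
  -- the output constant
  set C : ℝ := CA * (1 + Kmax) + 2 * CS * Emax with hCdef
  -- the CFL threshold
  obtain ⟨a₁, ha₁, hCFL⟩ := DeRosa.exists_threshold_cfl (β := β) hb1 hβ0 hα (lt_min hcA hcS) (2 * (CA * (1 + Kmax)))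
  refine ⟨C, max 2 a₁, lt_of_lt_of_le one_lt_two (le_max_left _ _),
    fun a ha T hT q vℓ pℓ Rℓ hER h213 h214 i v p hiT hex hanch => ?_⟩
  have ha2 : 2 ≤ a := le_trans (le_max_left _ _) ha
  have ha1 : 1 ≤ a := by linarith
  have haa₁ : a₁ ≤ a := le_trans (le_max_right _ _) ha
  -- the scales
  set τ := glueScale β α a b q with hτdef
  set ℓ := mollScale β α a b q with hℓdef
  set δ := amp β a b (q + 1) with hδdef
  set A := Real.sqrt (amp β a b q) * freq a b q with hAdef
  have hτ : 0 < τ := glueScale_pos ha1 q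
  have hℓ : 0 < ℓ := mollScale_pos ha1 q
  have hℓ1 : ℓ ≤ 1 := mollScale_le_one ha1 hb1 hβ0 hα.le q
  have hδ : 0 < δ := amp_pos ha1 (q + 1)
  have hA : 0 < A := mul_pos (Real.sqrt_pos.2 (amp_pos ha1 q)) (freq_pos ha1 q)
  have hΛ1 : 1 ≤ ℓ⁻¹ := one_le_inv_iff₀.2 ⟨hℓ, hℓ1⟩
  have hΛ0 : 0 < ℓ⁻¹ := by positivity
  -- the life span
  set a' := max ((i : ℝ) * τ - τ) 0 with ha'
  set b' := min ((i : ℝ) * τ + τ) T with hb'def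
  have hS : glueInterval T τ i = Icc a' b' := glueInterval_eq_Icc T τ i
  have hi0 : 0 ≤ (i : ℝ) * τ := by positivity
  have hab : a' < b' := by
    simp only [ha', hb'def, max_lt_iff, lt_min_iff]
    exact ⟨⟨by linarith, by linarith⟩, by linarith, hT⟩
  have hsub : Icc a' b' ⊆ Icc 0 T := by rw [← hS]; exact glueInterval_subset_Icc T τ i
  have hlen : b' - a' ≤ 2 * τ := by
    have h1 : b' ≤ (i : ℝ) * τ + τ := min_le_left _ _
    have h2 : (i : ℝ) * τ - τ ≤ a' := le_max_left _ _
    linarith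
  have hlen0 : 0 ≤ b' - a' := by linarith
  have ht₀ : (i : ℝ) * τ ∈ Icc a' b' := by
    rw [← hS]; exact anchor_mem_glueInterval hτ.le hiT
  have hexI : IsExactEulerOn (Icc a' b') v p := by rwa [hS] at hex
  have hℓI : Torus.IsEulerReynoldsOn (Icc a' b') vℓ pℓ Rℓ := hER.restrict hsub (uniqueDiffOn_Icc hab)
  -- the dimensionless data: `U = (1 + K) A ℓ^{-α}`, `Λ = ℓ⁻¹`, `E = E_max δ ℓ^α`
  set U : ℝ := (1 + Kmax) * (A * ℓ ^ (-α)) with hUdef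
  have hU : 0 < U := by positivity
  set E : ℝ := Emax * (δ * ℓ ^ α) with hEdef
  have hE0 : 0 ≤ E := by positivity
  -- (2.13) interpolated: `‖v_ℓ(t)‖_{m,α} ≤ U Λ^{m-1}` for `1 ≤ m ≤ N̄ + 1` on `[0,T]`
  have hvℓ : ∀ t ∈ Icc 0 T, ∀ m : ℕ, 1 ≤ m → m ≤ Nbar + 1 →
      Torus.eContDiffHolderNorm m α' (vℓ t) ≤ ENNReal.ofReal (U * ℓ⁻¹ ^ (m - 1)) := by
    intro t ht m hm1 hm2
    obtain ⟨N, rfl⟩ : ∃ N, m = N + 1 := ⟨m - 1, by omega⟩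
    have key := eContDiffHolderNorm_succ_le_of_holderSupLE (Cin := Cin) hα hα1 hℓ hℓ1 hA.le
      (fun s hs => hER.smooth_velocity.isSmooth_slice hs) h213 ht N
    refine key.trans (ENNReal.ofReal_le_ofReal ?_)
    rw [Nat.add_sub_cancel]
    have e : ℓ ^ (-(N : ℝ) - α) = ℓ ^ (-α) * ℓ⁻¹ ^ N := DeRosa.rpow_neg_natCast_sub hℓ α N
    rw [e]
    calc (((N : ℝ) + 4) * |Cin N| + |Cin (N + 1)|) * (A * (ℓ ^ (-α) * ℓ⁻¹ ^ N))
        ≤ Kmax * (A * (ℓ ^ (-α) * ℓ⁻¹ ^ N)) := mul_le_mul_of_nonneg_right (hKm N (by omega)) (by positivity)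
      _ ≤ (1 + Kmax) * (A * (ℓ ^ (-α) * ℓ⁻¹ ^ N)) :=
          mul_le_mul_of_nonneg_right (le_add_of_nonneg_left zero_le_one) (by positivity)
      _ = U * ℓ⁻¹ ^ N := by rw [hUdef]; ring
  -- (2.14): `‖R̊_ℓ(t)‖_{m,α} ≤ E Λ^m` for `m ≤ N̄ + 1`
  have hRℓ : ∀ t ∈ Icc 0 T, ∀ m : ℕ, m ≤ Nbar + 1 →
      Torus.eContDiffHolderNorm m α' (Rℓ t) ≤ ENNReal.ofReal (E * ℓ⁻¹ ^ m) := by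
    intro t ht m hm
    refine (h214 m t ht).trans (ENNReal.ofReal_le_ofReal ?_)
    have e : ℓ ^ (-(m : ℝ) + α) = ℓ ^ α * ℓ⁻¹ ^ m := DeRosa.rpow_neg_natCast_add hℓ α m
    rw [e]
    calc Cin m * (δ * (ℓ ^ α * ℓ⁻¹ ^ m)) ≤ |Cin m| * (δ * (ℓ ^ α * ℓ⁻¹ ^ m)) :=
          mul_le_mul_of_nonneg_right (le_abs_self _) (by positivity)
      _ ≤ Emax * (δ * (ℓ ^ α * ℓ⁻¹ ^ m)) := mul_le_mul_of_nonneg_right (hEm m hm) (by positivity)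
      _ = E * ℓ⁻¹ ^ m := by rw [hEdef]; ring
  -- the CFL conditions `(b' - a') U ≤ c_A`, `(b' - a') (C_A U) ≤ c_S`
  have hcfl : 2 * τ * (CA * U) ≤ min cA cS := by
    have e : 2 * τ * (CA * U) = 2 * (CA * (1 + Kmax)) * ℓ ^ α := by
      have h1 := glueScale_mul_cflBound (β := β) (α := α) (b := b) ha1 q (1 + Kmax)
      calc 2 * τ * (CA * U) = 2 * CA * (τ * ((1 + Kmax) * (A * ℓ ^ (-α)))) := by rw [hUdef]; ring
        _ = 2 * CA * ((1 + Kmax) * ℓ ^ α) := by rw [hτdef, hAdef, hℓdef, h1]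
        _ = 2 * (CA * (1 + Kmax)) * ℓ ^ α := by ring
    rw [e]
    exact hCFL a haa₁ q
  have hcflA : (b' - a') * U ≤ cA := by
    have h1 : (b' - a') * U ≤ 2 * τ * U := mul_le_mul_of_nonneg_right hlen hU.le
    have h2 : 2 * τ * U ≤ 2 * τ * (CA * U) := by
      have : U ≤ CA * U := le_mul_of_one_le_left hU.le hCA1
      exact mul_le_mul_of_nonneg_left this (by positivity)
    exact h1.trans (h2.trans (hcfl.trans (min_le_left _ _)))
  have hcflS : (b' - a') * (CA * U) ≤ cS :=
    ((mul_le_mul_of_nonneg_right hlen (by positivity)).trans hcfl).trans (min_le_right _ _)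
  -- Cor. 3.2: `‖v(t)‖_{m,α} ≤ C_A U Λ^{m-1}` for `1 ≤ m ≤ N̄ + 1` on the life span
  have hdat : ∀ m : ℕ, 1 ≤ m → m ≤ Nbar + 1 →
      Torus.eContDiffHolderNorm m α' (v ((i : ℝ) * τ)) ≤ ENNReal.ofReal (U * ℓ⁻¹ ^ (m - 1)) := by
    intro m hm1 hm2
    rw [hanch]
    exact hvℓ _ (hsub ht₀) m hm1 hm2
  have hv : ∀ t ∈ Icc a' b', ∀ m : ℕ, 1 ≤ m → m ≤ Nbar + 1 →
      Torus.eContDiffHolderNorm m α' (v t) ≤ ENNReal.ofReal (CA * U * ℓ⁻¹ ^ (m - 1)) :=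
    hAp hab hexI ht₀ hU hΛ1 hdat hcflA
  -- Prop. 3.3 with `U' = C_A U`
  have hCAU : 0 < CA * U := by positivity
  have hvℓ' : ∀ t ∈ Icc a' b', ∀ m : ℕ, 1 ≤ m → m ≤ Nbar + 1 →
      Torus.eContDiffHolderNorm m α' (vℓ t) ≤ ENNReal.ofReal (CA * U * ℓ⁻¹ ^ (m - 1)) := by
    intro t ht m hm1 hm2
    have h0 : 0 ≤ U * ℓ⁻¹ ^ (m - 1) := by positivity
    have key : U * ℓ⁻¹ ^ (m - 1) ≤ CA * U * ℓ⁻¹ ^ (m - 1) :=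
      calc U * ℓ⁻¹ ^ (m - 1) = 1 * (U * ℓ⁻¹ ^ (m - 1)) := (one_mul _).symm
        _ ≤ CA * (U * ℓ⁻¹ ^ (m - 1)) := mul_le_mul_of_nonneg_right hCA1 h0
        _ = CA * U * ℓ⁻¹ ^ (m - 1) := (mul_assoc _ _ _).symm
    exact (hvℓ t (hsub ht) m hm1 hm2).trans (ENNReal.ofReal_le_ofReal key)
  have hR' : ∀ t ∈ Icc a' b', ∀ m : ℕ, m ≤ Nbar + 1 →
      Torus.eContDiffHolderNorm m α' (Rℓ t) ≤ ENNReal.ofReal (E * ℓ⁻¹ ^ m) :=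
    fun t ht m hm => hRℓ t (hsub ht) m hm
  have hstab := hSt hab hℓI hexI ht₀ hanch hCAU hΛ1 hE0 hvℓ' hv hR' hcflS
  -- conversions of the right-hand sides
  have hconv6 : ∀ N : ℕ, CS * (b' - a') * E * ℓ⁻¹ ^ (N + 1) ≤ 2 * CS * Emax * (τ * δ * ℓ ^ (-(N : ℝ) - 1 + α)) := by
    intro N
    have e : τ * δ * ℓ ^ (-(N : ℝ) - 1 + α) = τ * (δ * ℓ ^ α) * ℓ⁻¹ ^ (N + 1) := by
      rw [DeRosa.rpow_neg_natCast_sub_one_add hℓ α N]; ring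
    rw [e]
    calc CS * (b' - a') * E * ℓ⁻¹ ^ (N + 1) ≤ CS * (2 * τ) * E * ℓ⁻¹ ^ (N + 1) :=
          mul_le_mul_of_nonneg_right (mul_le_mul_of_nonneg_right (mul_le_mul_of_nonneg_left hlen hCS0) hE0)
            (by positivity)
      _ = 2 * CS * Emax * (τ * (δ * ℓ ^ α) * ℓ⁻¹ ^ (N + 1)) := by rw [hEdef]; ring
  have hconv7 : ∀ N : ℕ, CS * E * ℓ⁻¹ ^ (N + 1) = CS * Emax * (δ * ℓ ^ (-(N : ℝ) - 1 + α)) := by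
    intro N
    rw [DeRosa.rpow_neg_natCast_sub_one_add hℓ α N, hEdef]; ring
  have hCSE : 0 ≤ CS * Emax := mul_nonneg hCS0 hEmax0
  have hCAK : 0 ≤ CA * (1 + Kmax) := by positivity
  have hCge6 : 2 * CS * Emax ≤ C := by
    have key : C - 2 * CS * Emax = CA * (1 + Kmax) := by rw [hCdef]; ring
    linarith only [key, hCAK]
  have hCge7 : CS * Emax ≤ C := by linarith only [hCge6, hCSE]
  refine ⟨?_, ?_, ?_, ?_⟩
  · -- Cor. 3.2: `‖v‖_{N+α} ≤ C τ⁻¹ ℓ^{1-N+α}`, `1 ≤ N ≤ N̄`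
    intro N hN1 hN t ht
    rw [hS] at ht
    refine (hv t ht N hN1 (by omega)).trans (ENNReal.ofReal_le_ofReal ?_)
    have e : τ⁻¹ * ℓ ^ (1 - (N : ℝ) + α) = A * ℓ ^ (-α) * ℓ⁻¹ ^ (N - 1) := by
      obtain ⟨M, rfl⟩ : ∃ M, N = M + 1 := ⟨N - 1, by omega⟩
      rw [hτdef, glueScale_inv_eq ha1 q, ← hAdef, ← hℓdef, Nat.add_sub_cancel]
      calc A * ℓ ^ (-(2 * α)) * ℓ ^ (1 - ((M + 1 : ℕ) : ℝ) + α)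
          = A * (ℓ ^ (-(2 * α)) * ℓ ^ (1 - ((M + 1 : ℕ) : ℝ) + α)) := mul_assoc _ _ _
        _ = A * (ℓ ^ (-α) * ℓ⁻¹ ^ M) := by rw [DeRosa.rpow_velocity_conversion hℓ α M]
        _ = A * ℓ ^ (-α) * ℓ⁻¹ ^ M := (mul_assoc _ _ _).symm
    rw [e]
    calc CA * U * ℓ⁻¹ ^ (N - 1) = CA * (1 + Kmax) * (A * ℓ ^ (-α) * ℓ⁻¹ ^ (N - 1)) := by rw [hUdef]; ring
      _ ≤ C * (A * ℓ ^ (-α) * ℓ⁻¹ ^ (N - 1)) := by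
          refine mul_le_mul_of_nonneg_right ?_ (by positivity)
          have key : C - CA * (1 + Kmax) = 2 * (CS * Emax) := by rw [hCdef]; ring
          linarith only [key, hCSE]
  · -- (3.6)
    intro N hN t ht
    rw [hS] at ht
    refine ((hstab t ht N hN).1).trans (ENNReal.ofReal_le_ofReal ?_)
    refine (hconv6 N).trans ?_
    exact mul_le_mul_of_nonneg_right hCge6 (by positivity)
  · -- (3.7): `‖∇(p_ℓ - p)‖_{N+α} = ‖∇(p - p_ℓ)‖_{N+α}`
    intro N hN t ht
    rw [hS] at ht
    have hps : IsSmooth (p t) := hexI.smooth_pressure.isSmooth_slice ht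
    have hpℓs : IsSmooth (pℓ t) := hℓI.smooth_pressure.isSmooth_slice ht
    have hd : IsSmooth (fun y => p t y - pℓ t y) := hps.sub hpℓs
    have e : (fun x => FunctionSpaces.Torus.gradient (fun y => pℓ t y - p t y) x) =
        (-1 : ℝ) • fun x => FunctionSpaces.Torus.gradient (fun y => p t y - pℓ t y) x := by
      funext x
      have e1 : (fun y => pℓ t y - p t y) = fun y => (-1 : ℝ) * (p t y - pℓ t y) := by
        funext y; ring
      rw [e1, Torus.gradient_const_mul_apply (hd.isContDiff (by simp))]
      simp
    show Torus.eContDiffHolderNorm N α' (fun x => FunctionSpaces.Torus.gradient (fun y => pℓ t y - p t y) x) ≤ _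
    rw [e, Torus.eContDiffHolderNorm_const_smul (hd.gradient.isContDiff (mod_cast le_top))]
    simp only [enorm_neg, enorm_one, one_mul]
    refine ((hstab t ht N hN).2.1).trans (ENNReal.ofReal_le_ofReal ?_)
    rw [hconv7 N]
    exact mul_le_mul_of_nonneg_right hCge7 (by positivity)
  · -- (3.8)
    intro N hN t ht
    rw [hS] at ht ⊢
    show Torus.eContDiffHolderNorm N α' (fun x => FunctionSpaces.Torus.timeDerivWithin (Icc a' b') (fun t y => v t y - vℓ t y) t x +
      FunctionSpaces.Torus.convect (vℓ t) (fun y => v t y - vℓ t y) x) ≤ _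
    refine ((hstab t ht N hN).2.2).trans (ENNReal.ofReal_le_ofReal ?_)
    rw [hconv7 N]
    exact mul_le_mul_of_nonneg_right hCge7 (by positivity)

end Stability

/-! ## Prop. 3.4 in the currency of the scheme -/

section Potential

set_option maxHeartbeats 800000 in
/-- **BDSV Prop. 3.4 for the scheme** ("`zᵢ - zᵢ₊₁ = z̃ᵢ - z̃ᵢ₊₁`. Hence, it suffices to estimate
`z̃ᵢ` in place of `zᵢ - zᵢ₊₁`": on the common life span `Sᵢ ∩ Sᵢ₊₁ = [tᵢ, tᵢ₊₁]` the solution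
`vᵢ` is anchored to `v_ℓ` at the left endpoint `tᵢ` (`BDSV.potentialStability_left`) and `vᵢ₊₁`
at the right endpoint `tᵢ₊₁` (`BDSV.potentialStability_right`), the bounds `‖v‖_{m+α}` of both
coming from Cor. 3.2 = `BDSV.holderCZBound.eulerApriori` on `Sᵢ`, `Sᵢ₊₁`): for `0 < β < 1/3`,
`1 < b < (1-β)/(2β)`, `0 < α < 1`, every `N̄` and input constants `(C_N)` there are `C`, `a₀ > 1`
such that for `a ≥ a₀`, `T > 0`, `q`, every Euler–Reynolds triple `(v_ℓ, p_ℓ, R̊_ℓ)` on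
`[0,T] × T³` with (2.13)–(2.14), every `i` with `tᵢ₊₁ = (i+1)τ_q ≤ T` and every pair of smooth
exact Euler solutions `(v, p)` on `Sᵢ` with `v(tᵢ) = v_ℓ(tᵢ)` and `(v', p')` on `Sᵢ₊₁` with
`v'(tᵢ₊₁) = v_ℓ(tᵢ₊₁)`: `BDSV.PotentialBounds β α a b T C q N̄ i v_ℓ v v'`.
[cite: BuckmasterEtAl2018, §3.3, Prop. 3.4] -/
theorem potentialBounds_of_exactEuler :
    ∀ β : ℝ, 0 < β → β < 1 / 3 → ∀ b : ℝ, 1 < b → b < (1 - β) / (2 * β) →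
      ∀ α : ℝ, 0 < α → α < 1 → ∀ (Nbar : ℕ) (Cin : ℕ → ℝ),
        ∃ (C a₀ : ℝ), 1 < a₀ ∧ ∀ a : ℝ, a₀ ≤ a → ∀ T : ℝ, 0 < T →
          ∀ (q : ℕ) (vℓ : ℝ → UnitAddTorus (Fin 3) → EuclideanSpace ℝ (Fin 3)) (pℓ : ℝ → UnitAddTorus (Fin 3) → ℝ) (Rℓ : ℝ → UnitAddTorus (Fin 3) → Fin 3 → EuclideanSpace ℝ (Fin 3)),
            Torus.IsEulerReynoldsOn (Icc 0 T) vℓ pℓ Rℓ →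
            (∀ N : ℕ, HolderSupLE T vℓ (N + 1) 0
              (Cin N * (Real.sqrt (amp β a b q) * freq a b q * mollScale β α a b q ^ (-(N : ℝ))))) →
            (∀ N : ℕ, HolderSupLE T Rℓ N (Real.toNNReal α)
              (Cin N * (amp β a b (q + 1) * mollScale β α a b q ^ (-(N : ℝ) + α)))) →
            ∀ (i : ℕ) (v : ℝ → UnitAddTorus (Fin 3) → EuclideanSpace ℝ (Fin 3)) (p : ℝ → UnitAddTorus (Fin 3) → ℝ) (v' : ℝ → UnitAddTorus (Fin 3) → EuclideanSpace ℝ (Fin 3)) (p' : ℝ → UnitAddTorus (Fin 3) → ℝ),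
              ((i + 1 : ℕ) : ℝ) * glueScale β α a b q ≤ T →
              IsExactEulerOn (glueInterval T (glueScale β α a b q) i) v p →
              v ((i : ℝ) * glueScale β α a b q) = vℓ ((i : ℝ) * glueScale β α a b q) →
              IsExactEulerOn (glueInterval T (glueScale β α a b q) (i + 1)) v' p' →
              v' (((i + 1 : ℕ) : ℝ) * glueScale β α a b q) =
                vℓ (((i + 1 : ℕ) : ℝ) * glueScale β α a b q) →
                PotentialBounds β α a b T C q Nbar i vℓ v v' := by
  intro β hβ _hβ3 b hb _hb' α hα hα1 Nbar Cin
  have hb1 : 1 ≤ b := hb.le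
  have hβ0 : 0 ≤ β := hβ.le
  set α' : ℝ≥0 := Real.toNNReal α with hα'def
  have hα' : 0 < α' := Real.toNNReal_pos.2 hα
  have hα1' : α' < 1 := Real.toNNReal_lt_one.2 hα1
  -- the dimensionless constants
  obtain ⟨cA, hcA, CA, hCA1, hAp⟩ := holderCZBound_holds.eulerApriori hα' hα1' (Nbar + 1)
  obtain ⟨cL, hcL, CL, hCL0, hLt⟩ := potentialStability_left hα' hα1' Nbar
  obtain ⟨cR, hcR, CR, hCR0, hRt⟩ := potentialStability_right hα' hα1' Nbar
  set CP : ℝ := max CL CR with hCPdef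
  have hCLP : CL ≤ CP := le_max_left _ _
  have hCRP : CR ≤ CP := le_max_right _ _
  have hCP0 : 0 ≤ CP := hCL0.trans hCLP
  -- the input constants, made uniform
  set Kmax : ℝ := ∑ m ∈ Finset.range (Nbar + 1), (((m : ℝ) + 4) * |Cin m| + |Cin (m + 1)|) with hKmax
  have hKmax0 : 0 ≤ Kmax := Finset.sum_nonneg fun _ _ => by positivity
  have hKm : ∀ m : ℕ, m ≤ Nbar → ((m : ℝ) + 4) * |Cin m| + |Cin (m + 1)| ≤ Kmax := fun m hm =>
    Finset.single_le_sum (f := fun m : ℕ => ((m : ℝ) + 4) * |Cin m| + |Cin (m + 1)|) (fun _ _ => by positivity)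
      (Finset.mem_range.2 (by omega))
  set Emax : ℝ := ∑ m ∈ Finset.range (Nbar + 1), |Cin m| with hEmax
  have hEmax0 : 0 ≤ Emax := Finset.sum_nonneg fun _ _ => abs_nonneg _
  have hEm : ∀ m : ℕ, m ≤ Nbar → |Cin m| ≤ Emax := fun m hm =>
    Finset.single_le_sum (f := fun m : ℕ => |Cin m|) (fun _ _ => abs_nonneg _) (Finset.mem_range.2 (by omega))
  -- the output constant
  set C : ℝ := 2 * CP * Emax with hCdef
  -- the CFL threshold
  obtain ⟨a₁, ha₁, hCFL⟩ := DeRosa.exists_threshold_cfl (β := β) hb1 hβ0 hα (lt_min hcA (lt_min hcL hcR))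
    (2 * (CA * (1 + Kmax)))
  refine ⟨C, max 2 a₁, lt_of_lt_of_le one_lt_two (le_max_left _ _),
    fun a ha T hT q vℓ pℓ Rℓ hER h213 h214 i v p v' p' hi1T hex hanch hex' hanch' => ?_⟩
  have ha2 : 2 ≤ a := le_trans (le_max_left _ _) ha
  have ha1 : 1 ≤ a := by linarith
  have haa₁ : a₁ ≤ a := le_trans (le_max_right _ _) ha
  -- the scales
  set τ := glueScale β α a b q with hτdef
  set ℓ := mollScale β α a b q with hℓdef
  set δ := amp β a b (q + 1) with hδdef
  set A := Real.sqrt (amp β a b q) * freq a b q with hAdef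
  have hτ : 0 < τ := glueScale_pos ha1 q
  have hℓ : 0 < ℓ := mollScale_pos ha1 q
  have hℓ1 : ℓ ≤ 1 := mollScale_le_one ha1 hb1 hβ0 hα.le q
  have hδ : 0 < δ := amp_pos ha1 (q + 1)
  have hA : 0 < A := mul_pos (Real.sqrt_pos.2 (amp_pos ha1 q)) (freq_pos ha1 q)
  have hΛ1 : 1 ≤ ℓ⁻¹ := one_le_inv_iff₀.2 ⟨hℓ, hℓ1⟩
  have hΛ0 : 0 < ℓ⁻¹ := by positivity
  have hi0 : 0 ≤ (i : ℝ) * τ := by positivity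
  have hcast : ((i + 1 : ℕ) : ℝ) * τ = (i : ℝ) * τ + τ := by push_cast; ring
  have hanchJ : ((i + 1 : ℕ) : ℝ) * τ ∈ glueInterval T τ (i + 1) := anchor_mem_glueInterval hτ.le hi1T
  rw [hcast] at hi1T hanch'
  have hiT : (i : ℝ) * τ ≤ T := by linarith
  -- the life spans `Sᵢ = [aI, bI]`, `Sᵢ₊₁ = [aJ, bJ]` and their intersection `[iτ, iτ + τ]`
  set aI := max ((i : ℝ) * τ - τ) 0 with haI
  set bI := min ((i : ℝ) * τ + τ) T with hbI
  set aJ := max (((i + 1 : ℕ) : ℝ) * τ - τ) 0 with haJ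
  set bJ := min (((i + 1 : ℕ) : ℝ) * τ + τ) T with hbJ
  have hSI : glueInterval T τ i = Icc aI bI := glueInterval_eq_Icc T τ i
  have hSJ : glueInterval T τ (i + 1) = Icc aJ bJ := glueInterval_eq_Icc T τ (i + 1)
  have haJeq : aJ = (i : ℝ) * τ := by rw [haJ, hcast, add_sub_cancel_right, max_eq_left hi0]
  have hbIeq : bI = (i : ℝ) * τ + τ := by rw [hbI, min_eq_left hi1T]
  have haIle : aI ≤ (i : ℝ) * τ := max_le (by linarith) hi0
  have hbJge : (i : ℝ) * τ + τ ≤ bJ := by rw [hbJ, hcast]; exact le_min (by linarith) hi1T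
  have habI : aI < bI := by rw [hbIeq]; linarith
  have habJ : aJ < bJ := by rw [haJeq]; linarith
  have hlt : (i : ℝ) * τ < (i : ℝ) * τ + τ := by linarith
  have hO : glueInterval T τ i ∩ glueInterval T τ (i + 1) = Icc ((i : ℝ) * τ) ((i : ℝ) * τ + τ) := by
    rw [hSI, hSJ, Icc_inter_Icc, haJeq, hbIeq, max_eq_right haIle, min_eq_left hbJge]
  have hOsubI : Icc ((i : ℝ) * τ) ((i : ℝ) * τ + τ) ⊆ Icc aI bI := Icc_subset_Icc haIle hbIeq.symm.le
  have hOsubJ : Icc ((i : ℝ) * τ) ((i : ℝ) * τ + τ) ⊆ Icc aJ bJ := Icc_subset_Icc haJeq.le hbJge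
  have hsubI : Icc aI bI ⊆ Icc 0 T := by rw [← hSI]; exact glueInterval_subset_Icc T τ i
  have hsubJ : Icc aJ bJ ⊆ Icc 0 T := by rw [← hSJ]; exact glueInterval_subset_Icc T τ (i + 1)
  have hOsub : Icc ((i : ℝ) * τ) ((i : ℝ) * τ + τ) ⊆ Icc 0 T := hOsubI.trans hsubI
  have hlenI : bI - aI ≤ 2 * τ := by
    have h2 : (i : ℝ) * τ - τ ≤ aI := le_max_left _ _
    linarith
  have hlenJ : bJ - aJ ≤ 2 * τ := by
    have h1 : bJ ≤ ((i + 1 : ℕ) : ℝ) * τ + τ := min_le_left _ _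
    rw [hcast] at h1
    linarith
  have ht₀I : (i : ℝ) * τ ∈ Icc aI bI := by rw [← hSI]; exact anchor_mem_glueInterval hτ.le hiT
  have ht₁J : (i : ℝ) * τ + τ ∈ Icc aJ bJ := by rw [hSJ, hcast] at hanchJ; exact hanchJ
  have hUO : UniqueDiffOn ℝ (Icc ((i : ℝ) * τ) ((i : ℝ) * τ + τ)) := uniqueDiffOn_Icc hlt
  -- the solutions on the three intervals
  have hexI : IsExactEulerOn (Icc aI bI) v p := by rwa [hSI] at hex
  have hexJ : IsExactEulerOn (Icc aJ bJ) v' p' := by rwa [hSJ] at hex'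
  have hexO : IsExactEulerOn (Icc ((i : ℝ) * τ) ((i : ℝ) * τ + τ)) v p := hexI.restrict hOsubI hUO
  have hexO' : IsExactEulerOn (Icc ((i : ℝ) * τ) ((i : ℝ) * τ + τ)) v' p' := hexJ.restrict hOsubJ hUO
  have hℓO : Torus.IsEulerReynoldsOn (Icc ((i : ℝ) * τ) ((i : ℝ) * τ + τ)) vℓ pℓ Rℓ := hER.restrict hOsub hUO
  -- the dimensionless data: `U = (1 + K) A ℓ^{-α}`, `Λ = ℓ⁻¹`, `E = E_max δ ℓ^α`
  set U : ℝ := (1 + Kmax) * (A * ℓ ^ (-α)) with hUdef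
  have hU : 0 < U := by positivity
  set E : ℝ := Emax * (δ * ℓ ^ α) with hEdef
  have hE0 : 0 ≤ E := by positivity
  -- (2.13) interpolated: `‖v_ℓ(t)‖_{m,α} ≤ U Λ^{m-1}` for `1 ≤ m ≤ N̄ + 1` on `[0,T]`
  have hvℓ : ∀ t ∈ Icc 0 T, ∀ m : ℕ, 1 ≤ m → m ≤ Nbar + 1 →
      Torus.eContDiffHolderNorm m α' (vℓ t) ≤ ENNReal.ofReal (U * ℓ⁻¹ ^ (m - 1)) := by
    intro t ht m hm1 hm2
    obtain ⟨N, rfl⟩ : ∃ N, m = N + 1 := ⟨m - 1, by omega⟩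
    have key := eContDiffHolderNorm_succ_le_of_holderSupLE (Cin := Cin) hα hα1 hℓ hℓ1 hA.le
      (fun s hs => hER.smooth_velocity.isSmooth_slice hs) h213 ht N
    refine key.trans (ENNReal.ofReal_le_ofReal ?_)
    rw [Nat.add_sub_cancel]
    have e : ℓ ^ (-(N : ℝ) - α) = ℓ ^ (-α) * ℓ⁻¹ ^ N := DeRosa.rpow_neg_natCast_sub hℓ α N
    rw [e]
    calc (((N : ℝ) + 4) * |Cin N| + |Cin (N + 1)|) * (A * (ℓ ^ (-α) * ℓ⁻¹ ^ N))
        ≤ Kmax * (A * (ℓ ^ (-α) * ℓ⁻¹ ^ N)) := mul_le_mul_of_nonneg_right (hKm N (by omega)) (by positivity)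
      _ ≤ (1 + Kmax) * (A * (ℓ ^ (-α) * ℓ⁻¹ ^ N)) :=
          mul_le_mul_of_nonneg_right (le_add_of_nonneg_left zero_le_one) (by positivity)
      _ = U * ℓ⁻¹ ^ N := by rw [hUdef]; ring
  -- (2.14): `‖R̊_ℓ(t)‖_{m,α} ≤ E Λ^m` for `m ≤ N̄`
  have hRℓ : ∀ t ∈ Icc 0 T, ∀ m : ℕ, m ≤ Nbar →
      Torus.eContDiffHolderNorm m α' (Rℓ t) ≤ ENNReal.ofReal (E * ℓ⁻¹ ^ m) := by
    intro t ht m hm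
    refine (h214 m t ht).trans (ENNReal.ofReal_le_ofReal ?_)
    have e : ℓ ^ (-(m : ℝ) + α) = ℓ ^ α * ℓ⁻¹ ^ m := DeRosa.rpow_neg_natCast_add hℓ α m
    rw [e]
    calc Cin m * (δ * (ℓ ^ α * ℓ⁻¹ ^ m)) ≤ |Cin m| * (δ * (ℓ ^ α * ℓ⁻¹ ^ m)) :=
          mul_le_mul_of_nonneg_right (le_abs_self _) (by positivity)
      _ ≤ Emax * (δ * (ℓ ^ α * ℓ⁻¹ ^ m)) := mul_le_mul_of_nonneg_right (hEm m hm) (by positivity)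
      _ = E * ℓ⁻¹ ^ m := by rw [hEdef]; ring
  -- the CFL conditions
  have hcfl : 2 * τ * (CA * U) ≤ min cA (min cL cR) := by
    have e : 2 * τ * (CA * U) = 2 * (CA * (1 + Kmax)) * ℓ ^ α := by
      have h1 := glueScale_mul_cflBound (β := β) (α := α) (b := b) ha1 q (1 + Kmax)
      calc 2 * τ * (CA * U) = 2 * CA * (τ * ((1 + Kmax) * (A * ℓ ^ (-α)))) := by rw [hUdef]; ring
        _ = 2 * CA * ((1 + Kmax) * ℓ ^ α) := by rw [hτdef, hAdef, hℓdef, h1]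
        _ = 2 * (CA * (1 + Kmax)) * ℓ ^ α := by ring
    rw [e]
    exact hCFL a haa₁ q
  have h2τU : 2 * τ * U ≤ 2 * τ * (CA * U) := by
    have : U ≤ CA * U := le_mul_of_one_le_left hU.le hCA1
    exact mul_le_mul_of_nonneg_left this (by positivity)
  have hcflI : (bI - aI) * U ≤ cA :=
    (mul_le_mul_of_nonneg_right hlenI hU.le).trans (h2τU.trans (hcfl.trans (min_le_left _ _)))
  have hcflJ : (bJ - aJ) * U ≤ cA :=
    (mul_le_mul_of_nonneg_right hlenJ hU.le).trans (h2τU.trans (hcfl.trans (min_le_left _ _)))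
  have hlenO : (i : ℝ) * τ + τ - (i : ℝ) * τ ≤ 2 * τ := by linarith
  have hcflOL : ((i : ℝ) * τ + τ - (i : ℝ) * τ) * (CA * U) ≤ cL :=
    ((mul_le_mul_of_nonneg_right hlenO (by positivity)).trans hcfl).trans ((min_le_right _ _).trans (min_le_left _ _))
  have hcflOR : ((i : ℝ) * τ + τ - (i : ℝ) * τ) * (CA * U) ≤ cR :=
    ((mul_le_mul_of_nonneg_right hlenO (by positivity)).trans hcfl).trans ((min_le_right _ _).trans (min_le_right _ _))
  -- Cor. 3.2 on the two life spans
  have hdatI : ∀ m : ℕ, 1 ≤ m → m ≤ Nbar + 1 →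
      Torus.eContDiffHolderNorm m α' (v ((i : ℝ) * τ)) ≤ ENNReal.ofReal (U * ℓ⁻¹ ^ (m - 1)) := by
    intro m hm1 hm2
    rw [hanch]
    exact hvℓ _ (hsubI ht₀I) m hm1 hm2
  have hdatJ : ∀ m : ℕ, 1 ≤ m → m ≤ Nbar + 1 →
      Torus.eContDiffHolderNorm m α' (v' ((i : ℝ) * τ + τ)) ≤ ENNReal.ofReal (U * ℓ⁻¹ ^ (m - 1)) := by
    intro m hm1 hm2
    rw [hanch']
    exact hvℓ _ (hsubJ ht₁J) m hm1 hm2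
  have hvI : ∀ t ∈ Icc aI bI, ∀ m : ℕ, 1 ≤ m → m ≤ Nbar + 1 →
      Torus.eContDiffHolderNorm m α' (v t) ≤ ENNReal.ofReal (CA * U * ℓ⁻¹ ^ (m - 1)) :=
    hAp habI hexI ht₀I hU hΛ1 hdatI hcflI
  have hvJ : ∀ t ∈ Icc aJ bJ, ∀ m : ℕ, 1 ≤ m → m ≤ Nbar + 1 →
      Torus.eContDiffHolderNorm m α' (v' t) ≤ ENNReal.ofReal (CA * U * ℓ⁻¹ ^ (m - 1)) :=
    hAp habJ hexJ ht₁J hU hΛ1 hdatJ hcflJ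
  -- Prop. 3.4 for `z̃ = ℬ(v - v_ℓ)` (left anchor) and `z̃' = ℬ(v' - v_ℓ)` (right anchor) on the intersection
  have hCAU : 0 < CA * U := by positivity
  have hvℓO : ∀ t ∈ Icc ((i : ℝ) * τ) ((i : ℝ) * τ + τ), ∀ m : ℕ, 1 ≤ m → m ≤ Nbar + 1 →
      Torus.eContDiffHolderNorm m α' (vℓ t) ≤ ENNReal.ofReal (CA * U * ℓ⁻¹ ^ (m - 1)) := by
    intro t ht m hm1 hm2
    have h0 : 0 ≤ U * ℓ⁻¹ ^ (m - 1) := by positivity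
    have key : U * ℓ⁻¹ ^ (m - 1) ≤ CA * U * ℓ⁻¹ ^ (m - 1) :=
      calc U * ℓ⁻¹ ^ (m - 1) = 1 * (U * ℓ⁻¹ ^ (m - 1)) := (one_mul _).symm
        _ ≤ CA * (U * ℓ⁻¹ ^ (m - 1)) := mul_le_mul_of_nonneg_right hCA1 h0
        _ = CA * U * ℓ⁻¹ ^ (m - 1) := (mul_assoc _ _ _).symm
    exact (hvℓ t (hOsub ht) m hm1 hm2).trans (ENNReal.ofReal_le_ofReal key)
  have hvO : ∀ t ∈ Icc ((i : ℝ) * τ) ((i : ℝ) * τ + τ), ∀ m : ℕ, 1 ≤ m → m ≤ Nbar + 1 →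
      Torus.eContDiffHolderNorm m α' (v t) ≤ ENNReal.ofReal (CA * U * ℓ⁻¹ ^ (m - 1)) :=
    fun t ht m hm1 hm2 => hvI t (hOsubI ht) m hm1 hm2
  have hv'O : ∀ t ∈ Icc ((i : ℝ) * τ) ((i : ℝ) * τ + τ), ∀ m : ℕ, 1 ≤ m → m ≤ Nbar + 1 →
      Torus.eContDiffHolderNorm m α' (v' t) ≤ ENNReal.ofReal (CA * U * ℓ⁻¹ ^ (m - 1)) :=
    fun t ht m hm1 hm2 => hvJ t (hOsubJ ht) m hm1 hm2
  have hRO : ∀ t ∈ Icc ((i : ℝ) * τ) ((i : ℝ) * τ + τ), ∀ m : ℕ, m ≤ Nbar →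
      Torus.eContDiffHolderNorm m α' (Rℓ t) ≤ ENNReal.ofReal (E * ℓ⁻¹ ^ m) :=
    fun t ht m hm => hRℓ t (hOsub ht) m hm
  have hzL := hLt hlt hℓO hexO hanch hCAU hΛ1 hE0 hvℓO hvO hRO hcflOL
  have hzR := hRt hlt hℓO hexO' hanch' hCAU hΛ1 hE0 hvℓO hv'O hRO hcflOR
  -- conversions of the right-hand sides
  have hτsub : (i : ℝ) * τ + τ - (i : ℝ) * τ = τ := by ring
  have eX : ∀ N : ℕ, CP * τ * E * ℓ⁻¹ ^ N = CP * Emax * (τ * δ * ℓ ^ (-(N : ℝ) + α)) := by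
    intro N
    rw [DeRosa.rpow_neg_natCast_add hℓ α N, hEdef]; ring
  have eY : ∀ N : ℕ, CP * E * ℓ⁻¹ ^ N = CP * Emax * (δ * ℓ ^ (-(N : ℝ) + α)) := by
    intro N
    rw [DeRosa.rpow_neg_natCast_add hℓ α N, hEdef]; ring
  have hXle : ∀ {K : ℝ}, K ≤ CP → ∀ N : ℕ, K * ((i : ℝ) * τ + τ - (i : ℝ) * τ) * E * ℓ⁻¹ ^ N ≤ CP * τ * E * ℓ⁻¹ ^ N := by
    intro K hK N
    rw [hτsub]
    exact mul_le_mul_of_nonneg_right (mul_le_mul_of_nonneg_right (mul_le_mul_of_nonneg_right hK hτ.le) hE0) (by positivity)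
  have hYle : ∀ {K : ℝ}, K ≤ CP → ∀ N : ℕ, K * E * ℓ⁻¹ ^ N ≤ CP * E * ℓ⁻¹ ^ N := fun hK N =>
    mul_le_mul_of_nonneg_right (mul_le_mul_of_nonneg_right hK hE0) (by positivity)
  -- smoothness on the intersection, and `ℬ(v - v') = z̃ - z̃'`
  have hws : ∀ t ∈ Icc ((i : ℝ) * τ) ((i : ℝ) * τ + τ), IsSmooth (fun y => v t y - vℓ t y) := fun t ht =>
    (hexO.smooth_velocity.isSmooth_slice ht).sub (hℓO.smooth_velocity.isSmooth_slice ht)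
  have hws' : ∀ t ∈ Icc ((i : ℝ) * τ) ((i : ℝ) * τ + τ), IsSmooth (fun y => v' t y - vℓ t y) := fun t ht =>
    (hexO'.smooth_velocity.isSmooth_slice ht).sub (hℓO.smooth_velocity.isSmooth_slice ht)
  have hdiff : ∀ t ∈ Icc ((i : ℝ) * τ) ((i : ℝ) * τ + τ), biotSavart (fun y => v t y - v' t y) =
      biotSavart (fun y => v t y - vℓ t y) - biotSavart (fun y => v' t y - vℓ t y) := by
    intro t ht
    have h1 : (fun y => v t y - v' t y) = (fun y => v t y - vℓ t y) - fun y => v' t y - vℓ t y := by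
      funext y; simp only [Pi.sub_apply]; abel
    rw [h1, biotSavart_sub (hws t ht) (hws' t ht)]
  have hZO : FunctionSpaces.Torus.IsSmoothSpaceTimeOn (Icc ((i : ℝ) * τ) ((i : ℝ) * τ + τ))
      (fun t y => biotSavart (fun z => v t z - vℓ t z) y) :=
    isSmoothSpaceTimeOn_biotSavart (hexO.smooth_velocity.sub hℓO.smooth_velocity) (convex_Icc _ _)
      (by rw [interior_Icc]; exact nonempty_Ioo.2 hlt)
  have hZ'O : FunctionSpaces.Torus.IsSmoothSpaceTimeOn (Icc ((i : ℝ) * τ) ((i : ℝ) * τ + τ))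
      (fun t y => biotSavart (fun z => v' t z - vℓ t z) y) :=
    isSmoothSpaceTimeOn_biotSavart (hexO'.smooth_velocity.sub hℓO.smooth_velocity) (convex_Icc _ _)
      (by rw [interior_Icc]; exact nonempty_Ioo.2 hlt)
  have hC2 : ∀ x : ℝ, 2 * (CP * Emax * x) = C * x := fun x => by rw [hCdef]; ring
  refine ⟨?_, ?_⟩
  · -- Prop. 3.4, first estimate
    intro N hN t ht
    rw [hO] at ht
    have h1 := ((hzL t ht N hN).1).trans (ENNReal.ofReal_le_ofReal ((hXle hCLP N).trans (eX N).le))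
    have h2 := ((hzR t ht N hN).1).trans (ENNReal.ofReal_le_ofReal ((hXle hCRP N).trans (eX N).le))
    show Torus.eContDiffHolderNorm N α' (fun x => biotSavart (fun y => v t y - v' t y) x) ≤ _
    rw [show (fun x => biotSavart (fun y => v t y - v' t y) x) = biotSavart (fun y => v t y - v' t y) from rfl,
      hdiff t ht]
    refine (Torus.eContDiffHolderNorm_sub_le ((isSmooth_biotSavart (hws t ht)).isContDiff (mod_cast le_top))
      ((isSmooth_biotSavart (hws' t ht)).isContDiff (mod_cast le_top))).trans ?_
    refine (add_le_add h1 h2).trans ?_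
    rw [DeRosa.ofReal_add_self_eq, hC2]
  · -- Prop. 3.4, second estimate
    intro N hN t ht
    rw [hO] at ht ⊢
    have h1 := ((hzL t ht N hN).2).trans (ENNReal.ofReal_le_ofReal ((hYle hCLP N).trans (eY N).le))
    have h2 := ((hzR t ht N hN).2).trans (ENNReal.ofReal_le_ofReal ((hYle hCRP N).trans (eY N).le))
    have hZt : IsSmooth (biotSavart (fun y => v t y - vℓ t y)) := isSmooth_biotSavart (hws t ht)
    have hZ't : IsSmooth (biotSavart (fun y => v' t y - vℓ t y)) := isSmooth_biotSavart (hws' t ht)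
    have hvℓt : IsSmooth (vℓ t) := hℓO.smooth_velocity.isSmooth_slice ht
    -- the transport derivative of `ℬ(v - v')` is the difference of those of `z̃`, `z̃'`
    have key : advectiveDerivWithin (Icc ((i : ℝ) * τ) ((i : ℝ) * τ + τ)) vℓ
        (fun t x => biotSavart (fun y => v t y - v' t y) x) t =
        (fun x => FunctionSpaces.Torus.timeDerivWithin (Icc ((i : ℝ) * τ) ((i : ℝ) * τ + τ))
            (fun t y => biotSavart (fun z => v t z - vℓ t z) y) t x +
          FunctionSpaces.Torus.convect (vℓ t) (biotSavart (fun y => v t y - vℓ t y)) x) -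
        fun x => FunctionSpaces.Torus.timeDerivWithin (Icc ((i : ℝ) * τ) ((i : ℝ) * τ + τ))
            (fun t y => biotSavart (fun z => v' t z - vℓ t z) y) t x +
          FunctionSpaces.Torus.convect (vℓ t) (biotSavart (fun y => v' t y - vℓ t y)) x := by
      funext x
      simp only [advectiveDerivWithin, Pi.sub_apply]
      have e1 : FunctionSpaces.Torus.timeDerivWithin (Icc ((i : ℝ) * τ) ((i : ℝ) * τ + τ))
          (fun t x => biotSavart (fun y => v t y - v' t y) x) t x =
          FunctionSpaces.Torus.timeDerivWithin (Icc ((i : ℝ) * τ) ((i : ℝ) * τ + τ))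
          (fun t x => biotSavart (fun z => v t z - vℓ t z) x - biotSavart (fun z => v' t z - vℓ t z) x) t x := by
        unfold FunctionSpaces.Torus.timeDerivWithin
        refine derivWithin_congr (fun r hr => ?_) ?_
        · show biotSavart (fun y => v r y - v' r y) x = biotSavart (fun z => v r z - vℓ r z) x - biotSavart (fun z => v' r z - vℓ r z) x
          rw [hdiff r hr]; rfl
        · show biotSavart (fun y => v t y - v' t y) x = biotSavart (fun z => v t z - vℓ t z) x - biotSavart (fun z => v' t z - vℓ t z) x
          rw [hdiff t ht]; rfl
      have e2 : FunctionSpaces.Torus.timeDerivWithin (Icc ((i : ℝ) * τ) ((i : ℝ) * τ + τ))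
          (fun t x => biotSavart (fun z => v t z - vℓ t z) x - biotSavart (fun z => v' t z - vℓ t z) x) t x =
          FunctionSpaces.Torus.timeDerivWithin (Icc ((i : ℝ) * τ) ((i : ℝ) * τ + τ))
            (fun t y => biotSavart (fun z => v t z - vℓ t z) y) t x -
          FunctionSpaces.Torus.timeDerivWithin (Icc ((i : ℝ) * τ) ((i : ℝ) * τ + τ))
            (fun t y => biotSavart (fun z => v' t z - vℓ t z) y) t x :=
        timeDerivWithin_sub' hZO hZ'O hUO ht x
      have e3 : FunctionSpaces.Torus.convect (vℓ t) (fun x => biotSavart (fun y => v t y - v' t y) x) x =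
          FunctionSpaces.Torus.convect (vℓ t) (biotSavart (fun y => v t y - vℓ t y)) x -
            FunctionSpaces.Torus.convect (vℓ t) (biotSavart (fun y => v' t y - vℓ t y)) x := by
        rw [show (fun x => biotSavart (fun y => v t y - v' t y) x) = biotSavart (fun y => v t y - v' t y) from rfl,
          hdiff t ht, convect_sub_right (hZt.isContDiff (by simp)) (hZ't.isContDiff (by simp))]
      rw [e1, e2, e3]
      abel
    rw [key]
    have hs1 : IsSmooth (fun x => FunctionSpaces.Torus.timeDerivWithin (Icc ((i : ℝ) * τ) ((i : ℝ) * τ + τ))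
          (fun t y => biotSavart (fun z => v t z - vℓ t z) y) t x +
        FunctionSpaces.Torus.convect (vℓ t) (biotSavart (fun y => v t y - vℓ t y)) x) :=
      ((hZO.timeDerivWithin hUO).isSmooth_slice ht).add (hvℓt.convect hZt)
    have hs2 : IsSmooth (fun x => FunctionSpaces.Torus.timeDerivWithin (Icc ((i : ℝ) * τ) ((i : ℝ) * τ + τ))
          (fun t y => biotSavart (fun z => v' t z - vℓ t z) y) t x +
        FunctionSpaces.Torus.convect (vℓ t) (biotSavart (fun y => v' t y - vℓ t y)) x) :=
      ((hZ'O.timeDerivWithin hUO).isSmooth_slice ht).add (hvℓt.convect hZ't)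
    refine (Torus.eContDiffHolderNorm_sub_le (hs1.isContDiff (mod_cast le_top)) (hs2.isContDiff (mod_cast le_top))).trans ?_
    refine (add_le_add h1 h2).trans ?_
    rw [DeRosa.ofReal_add_self_eq, hC2]

end Potential

/-! ## The discharge -/

section Discharge

/-- **Discharge of `BDSV.gluingStability`** (BDSV §3: Cor. 3.2, Prop. 3.3 and Prop. 3.4 in the
currency of the scheme, for every smooth exact Euler solution anchored to `v_ℓ` at `tᵢ`, resp.
every pair anchored at `tᵢ`, `tᵢ₊₁`): `BDSV.stabilityBounds_of_exactEuler` and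
`BDSV.potentialBounds_of_exactEuler` with a common constant (`BDSV.StabilityBounds.mono_const`,
`BDSV.PotentialBounds.mono_const`) and threshold; any `α₀ ≤ 1` works, here `α₀ = 1`.
[cite: BuckmasterEtAl2018, §3 (Cor. 3.2, Prop. 3.3, Prop. 3.4)] -/
theorem gluingStability_holds : gluingStability := by
  intro β hβ hβ3 b hb hb'
  refine ⟨1, one_pos, fun α hα hα1 Nbar Cin => ?_⟩
  obtain ⟨C₁, a₁, ha₁, h₁⟩ := stabilityBounds_of_exactEuler β hβ hβ3 b hb hb' α hα hα1 Nbar Cin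
  obtain ⟨C₂, a₂, -, h₂⟩ := potentialBounds_of_exactEuler β hβ hβ3 b hb hb' α hα hα1 Nbar Cin
  refine ⟨max C₁ C₂, max a₁ a₂, lt_of_lt_of_le ha₁ (le_max_left _ _),
    fun a ha T hT q vℓ pℓ Rℓ hER h213 h214 => ⟨?_, ?_⟩⟩
  · intro i v p hiT hex hanch
    have ha1 : 1 ≤ a := ha₁.le.trans ((le_max_left _ _).trans ha)
    exact (h₁ a ((le_max_left _ _).trans ha) T hT q vℓ pℓ Rℓ hER h213 h214 i v p hiT hex hanch).mono_const
      ha1 (le_max_left _ _)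
  · intro i v p v' p' hi1T hex hanch hex' hanch'
    have ha1 : 1 ≤ a := ha₁.le.trans ((le_max_left _ _).trans ha)
    exact (h₂ a ((le_max_right _ _).trans ha) T hT q vℓ pℓ Rℓ hER h213 h214 i v p v' p' hi1T hex hanch hex'
      hanch').mono_const ha1 (le_max_right _ _)

end Discharge

end BDSV

end Literature.Analysis.FluidPDE
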